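import Summits.CriticalPhenomena.PercolationContinuityZ3.Theorems.PercNearOneGluingNoHeavyLowerTailApexForestGluing
import HarnessLib

/-!
# Kozma–Nitzan Conjecture 1 on APEX-FOREST graphs — the packaged theorems
# (`NoHeavyLowerTail` cell, stmt-CriticalPhenomena-4575; new-inequality factory seat `prim-ineq-gen-7`, gen 4)

Support file (`--supports stmt-CriticalPhenomena-4575`); no definitions, no named facts, no sorries.  Corollaries of the forest induction
`ApexForest.eventGluing_aux` (`…ApexForestGluing`); paper proof run/shared/lean/prim/prim-ineq-gen-7/PROOF-CONJ1-APEXFOREST.md.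

SETTING (an APEX-FOREST instance): vertices `Fin n`, independent pairs with weights `w` (`μ = prodBernoulli w`), a hub `c`, a finite set `D` of pairs
avoiding `c` whose graph `fromEdgeSet D` is ACYCLIC, every pair outside `D` not containing `c` having weight `0` — i.e. `G − c` is a forest (the lead's
"Steiner-tree access with hub core", LEAD-GEN6 §3c), hub pairs arbitrary; `A` any nonempty relay set, `o ≠ c` any observer.

* `ApexForest.eventGluing` — **`μ(o ↔ A, o ↮ c) ≤ max_{a∈A} μ(a ↮ c) · μ(o ↔ A ∪ {c})`** (sharp form; equality on series configurations).
* `ApexForest.conj1` — **KOZMA–NITZAN CONJECTURE 1 on apex-forests**: `min_{a∈A} μ(a ↔ c) · μ(o ↔ A) ≤ μ(o ↔ c)`, all `|A|`, all depths, all branchings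
  (in print: `|A|`-special cases and paths, KN Theorems 1, 4, 5).
* `ApexForest.eventGluing_one` — event gluing with constant `1`: `μ(o ↔ A, o ↮ c) ≤ max_a μ(a ↮ c)`.
* `ApexForest.nearOneGluing_one` — near-one gluing with constant `1`: `μ(o ↮ c) ≤ μ(o ↮ A) + max_a μ(a ↮ c)` (the `NearOneGluing` / `NoHeavyLowerTail`
  shape of crux stmt-4575 on this class, with the sharp constant).
[cite: KozmaNitzan2024, Conjecture 1 (p. 3, (1)); Theorems 1, 4, 5] [cite: Grimmett1999, §1.3, §2.2]
-/

namespace Summit.CriticalPhenomena.PercolationContinuityZ3.Theorems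

namespace ApexForest

open MeasureTheory Set Literature.Probability.LatticeModels Literature.Probability.Percolation
open scoped Classical

variable {n : ℕ}

/-- **Kozma–Nitzan Conjecture 1 on apex-forest graphs, sharp gluing form**: if `G − c` is a forest (the pairs of positive weight not containing the hub `c`
form an acyclic graph), then for every observer `o ≠ c` and every nonempty relay set `A`,
`μ(o ↔ A, o ↮ c) ≤ max_{a∈A} μ(a ↮ c) · μ(o ↔ A ∪ {c})` — uniformly in `|A|`, depth and branching; tight on every series configuration.
[cite: KozmaNitzan2024, Conjecture 1 (p. 3, (1))] -/
theorem eventGluing (w : Sym2 (Fin n) → unitInterval) (c : Fin n) (D : Finset (Sym2 (Fin n)))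
    (hDc : ∀ p ∈ D, c ∉ p) (hacyc : (SimpleGraph.fromEdgeSet (↑D : Set (Sym2 (Fin n)))).IsAcyclic)
    (hw : ∀ p : Sym2 (Fin n), p ∉ D → c ∉ p → (w p : ℝ) = 0)
    (A : Finset (Fin n)) (hA : A.Nonempty) (o : Fin n) (hoc : o ≠ c) :
    (prodBernoulli w).real ((⋃ a ∈ A, (openConn o a : Set (BondConfig (Fin n)))) ∩ (openConn o c : Set (BondConfig (Fin n)))ᶜ) ≤
      A.sup' hA (fun a => (prodBernoulli w).real (openConn a c : Set (BondConfig (Fin n)))ᶜ) *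
        (prodBernoulli w).real (⋃ a ∈ insert c A, (openConn o a : Set (BondConfig (Fin n)))) := by
  obtain ⟨α, hαA, hle⟩ := eventGluing_aux D.card D w c o A rfl hDc hacyc hw hoc hA
  have hle1 : ∀ E : Set (BondConfig (Fin n)), (prodBernoulli w).real E ≤ 1 := fun E =>
    (measureReal_mono (Set.subset_univ E)).trans_eq probReal_univ
  have hX : (prodBernoulli w).real ((⋃ a ∈ A, (openConn o a : Set (BondConfig (Fin n)))) ∩ (openConn o c : Set (BondConfig (Fin n)))ᶜ) =
      (prodBernoulli w).real (openConn o c : Set (BondConfig (Fin n)))ᶜ -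
        (prodBernoulli w).real ((openConn o c : Set (BondConfig (Fin n)))ᶜ ∩
          (⋃ a ∈ A, (openConn o a : Set (BondConfig (Fin n))))ᶜ) := by
    have h1 : (prodBernoulli w).real ((openConn o c : Set (BondConfig (Fin n)))ᶜ ∩ ⋃ a ∈ A, (openConn o a : Set (BondConfig (Fin n)))) +
        (prodBernoulli w).real ((openConn o c : Set (BondConfig (Fin n)))ᶜ \ ⋃ a ∈ A, (openConn o a : Set (BondConfig (Fin n)))) =
        (prodBernoulli w).real (openConn o c : Set (BondConfig (Fin n)))ᶜ :=
      measureReal_inter_add_sdiff MeasurableSet.of_discrete (measure_ne_top _ _)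
    rw [Set.sdiff_eq] at h1
    rw [Set.inter_comm]
    linarith
  have hY : (prodBernoulli w).real (⋃ a ∈ insert c A, (openConn o a : Set (BondConfig (Fin n)))) =
      1 - (prodBernoulli w).real ((openConn o c : Set (BondConfig (Fin n)))ᶜ ∩
        (⋃ a ∈ A, (openConn o a : Set (BondConfig (Fin n))))ᶜ) := by
    rw [Finset.set_biUnion_insert, ← Set.compl_union, measureReal_compl MeasurableSet.of_discrete, probReal_univ]
    ring
  rw [hX, hY]
  exact hle.trans (mul_le_mul_of_nonneg_right (Finset.le_sup' (fun a => (prodBernoulli w).real (openConn a c : Set (BondConfig (Fin n)))ᶜ) hαA)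
    (sub_nonneg.2 (hle1 _)))

/-- **Kozma–Nitzan CONJECTURE 1 on apex-forest graphs**: if `G − c` is a forest then for every `o ≠ c` and nonempty `A`,
`P(o ↔ c) ≥ P(o ↔ A) · min_{a∈A} P(a ↔ c)` — Kozma–Nitzan prove this in print for `|A| ≤ 2`-type configurations and paths (Theorems 1, 4, 5); here it holds
for the whole class, all `|A|`, all depths. [cite: KozmaNitzan2024, Conjecture 1 (p. 3, (1))] -/
theorem conj1 (w : Sym2 (Fin n) → unitInterval) (c : Fin n) (D : Finset (Sym2 (Fin n)))
    (hDc : ∀ p ∈ D, c ∉ p) (hacyc : (SimpleGraph.fromEdgeSet (↑D : Set (Sym2 (Fin n)))).IsAcyclic)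
    (hw : ∀ p : Sym2 (Fin n), p ∉ D → c ∉ p → (w p : ℝ) = 0)
    (A : Finset (Fin n)) (hA : A.Nonempty) (o : Fin n) (hoc : o ≠ c) :
    A.inf' hA (fun a => (prodBernoulli w).real (openConn a c : Set (BondConfig (Fin n)))) *
        (prodBernoulli w).real (⋃ a ∈ A, (openConn o a : Set (BondConfig (Fin n)))) ≤
      (prodBernoulli w).real (openConn o c : Set (BondConfig (Fin n))) := by
  obtain ⟨α, hαA, hle⟩ := eventGluing_aux D.card D w c o A rfl hDc hacyc hw hoc hA
  set P := (prodBernoulli w).real (openConn o c : Set (BondConfig (Fin n))) with hP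
  set U := (prodBernoulli w).real (⋃ a ∈ A, (openConn o a : Set (BondConfig (Fin n)))) with hU
  set Z := (prodBernoulli w).real ((openConn o c : Set (BondConfig (Fin n)))ᶜ ∩ ⋃ a ∈ A, (openConn o a : Set (BondConfig (Fin n)))) with hZ
  set B := (prodBernoulli w).real ((openConn o c : Set (BondConfig (Fin n)))ᶜ ∩
    (⋃ a ∈ A, (openConn o a : Set (BondConfig (Fin n))))ᶜ) with hB
  set m := A.inf' hA (fun a => (prodBernoulli w).real (openConn a c : Set (BondConfig (Fin n)))) with hm
  set mα := (prodBernoulli w).real (openConn α c : Set (BondConfig (Fin n))) with hmα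
  have hN : (prodBernoulli w).real (openConn o c : Set (BondConfig (Fin n)))ᶜ = 1 - P := by
    rw [measureReal_compl MeasurableSet.of_discrete, probReal_univ]
  have hNZB : (prodBernoulli w).real (openConn o c : Set (BondConfig (Fin n)))ᶜ = Z + B := by
    have h1 : Z + (prodBernoulli w).real ((openConn o c : Set (BondConfig (Fin n)))ᶜ \ ⋃ a ∈ A, (openConn o a : Set (BondConfig (Fin n)))) =
        (prodBernoulli w).real (openConn o c : Set (BondConfig (Fin n)))ᶜ :=
      measureReal_inter_add_sdiff MeasurableSet.of_discrete (measure_ne_top _ _)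
    rw [Set.sdiff_eq] at h1
    exact h1.symm
  have hUle : U ≤ P + Z := by
    have h1 : (prodBernoulli w).real ((⋃ a ∈ A, (openConn o a : Set (BondConfig (Fin n)))) ∩ (openConn o c : Set (BondConfig (Fin n)))) +
        (prodBernoulli w).real ((⋃ a ∈ A, (openConn o a : Set (BondConfig (Fin n)))) \ (openConn o c : Set (BondConfig (Fin n)))) = U :=
      measureReal_inter_add_sdiff MeasurableSet.of_discrete (measure_ne_top _ _)
    have h2 : (prodBernoulli w).real ((⋃ a ∈ A, (openConn o a : Set (BondConfig (Fin n)))) ∩ (openConn o c : Set (BondConfig (Fin n)))) ≤ P :=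
      measureReal_mono Set.inter_subset_right
    have h3 : (prodBernoulli w).real ((⋃ a ∈ A, (openConn o a : Set (BondConfig (Fin n)))) \ (openConn o c : Set (BondConfig (Fin n)))) = Z := by
      rw [hZ, Set.sdiff_eq, Set.inter_comm]
    linarith
  have hdα : (prodBernoulli w).real (openConn α c : Set (BondConfig (Fin n)))ᶜ = 1 - mα := by
    rw [measureReal_compl MeasurableSet.of_discrete, probReal_univ]
  have hmα_le : m ≤ mα := Finset.inf'_le _ hαA
  have hm0 : 0 ≤ m := Finset.le_inf' _ _ (fun a _ => measureReal_nonneg)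
  have hZ0 : 0 ≤ Z := measureReal_nonneg
  have hP0 : 0 ≤ P := measureReal_nonneg
  rw [hNZB, hdα] at hle
  -- `hle : Z + B - B ≤ (1 - mα) * (1 - B)` with `1 - B = P + Z`
  have h1B : 1 - B = P + Z := by linarith
  rw [h1B] at hle
  have h3 : mα * (P + Z) ≤ P := by nlinarith
  calc m * U ≤ m * (P + Z) := mul_le_mul_of_nonneg_left hUle hm0
    _ ≤ mα * (P + Z) := mul_le_mul_of_nonneg_right hmα_le (by linarith)
    _ ≤ P := h3

/-- **Event gluing with constant `1` on apex-forests**: `μ(o ↔ A, o ↮ c) ≤ max_{a∈A} μ(a ↮ c)`. [cite: KozmaNitzan2024, Conjecture 1 (p. 3, (1))] -/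
theorem eventGluing_one (w : Sym2 (Fin n) → unitInterval) (c : Fin n) (D : Finset (Sym2 (Fin n)))
    (hDc : ∀ p ∈ D, c ∉ p) (hacyc : (SimpleGraph.fromEdgeSet (↑D : Set (Sym2 (Fin n)))).IsAcyclic)
    (hw : ∀ p : Sym2 (Fin n), p ∉ D → c ∉ p → (w p : ℝ) = 0)
    (A : Finset (Fin n)) (hA : A.Nonempty) (o : Fin n) (hoc : o ≠ c) :
    (prodBernoulli w).real ((⋃ a ∈ A, (openConn o a : Set (BondConfig (Fin n)))) ∩ (openConn o c : Set (BondConfig (Fin n)))ᶜ) ≤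
      A.sup' hA (fun a => (prodBernoulli w).real (openConn a c : Set (BondConfig (Fin n)))ᶜ) := by
  have hle1 : ∀ E : Set (BondConfig (Fin n)), (prodBernoulli w).real E ≤ 1 := fun E =>
    (measureReal_mono (Set.subset_univ E)).trans_eq probReal_univ
  obtain ⟨α, hαA⟩ := hA
  have hM0 : 0 ≤ A.sup' ⟨α, hαA⟩ (fun a => (prodBernoulli w).real (openConn a c : Set (BondConfig (Fin n)))ᶜ) :=
    le_trans measureReal_nonneg (Finset.le_sup' (fun a => (prodBernoulli w).real (openConn a c : Set (BondConfig (Fin n)))ᶜ) hαA)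
  exact (eventGluing w c D hDc hacyc hw A ⟨α, hαA⟩ o hoc).trans (mul_le_of_le_one_right hM0 (hle1 _))

/-- **Near-one gluing with constant `1` on apex-forests**: `μ(o ↮ c) ≤ μ(o ↮ A) + max_{a∈A} μ(a ↮ c)` — the `NearOneGluing` shape of the crux, with the sharp
constant, on every apex-forest instance. [cite: KozmaNitzan2024, Conjecture 1 (p. 3, (1))] -/
theorem nearOneGluing_one (w : Sym2 (Fin n) → unitInterval) (c : Fin n) (D : Finset (Sym2 (Fin n)))
    (hDc : ∀ p ∈ D, c ∉ p) (hacyc : (SimpleGraph.fromEdgeSet (↑D : Set (Sym2 (Fin n)))).IsAcyclic)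
    (hw : ∀ p : Sym2 (Fin n), p ∉ D → c ∉ p → (w p : ℝ) = 0)
    (A : Finset (Fin n)) (hA : A.Nonempty) (o : Fin n) (hoc : o ≠ c) :
    (prodBernoulli w).real (openConn o c : Set (BondConfig (Fin n)))ᶜ ≤
      (prodBernoulli w).real (⋃ a ∈ A, (openConn o a : Set (BondConfig (Fin n))))ᶜ +
        A.sup' hA (fun a => (prodBernoulli w).real (openConn a c : Set (BondConfig (Fin n)))ᶜ) := by
  have hX := eventGluing_one w c D hDc hacyc hw A hA o hoc
  have h1 : (prodBernoulli w).real ((openConn o c : Set (BondConfig (Fin n)))ᶜ ∩ ⋃ a ∈ A, (openConn o a : Set (BondConfig (Fin n)))) +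
      (prodBernoulli w).real ((openConn o c : Set (BondConfig (Fin n)))ᶜ \ ⋃ a ∈ A, (openConn o a : Set (BondConfig (Fin n)))) =
      (prodBernoulli w).real (openConn o c : Set (BondConfig (Fin n)))ᶜ :=
    measureReal_inter_add_sdiff MeasurableSet.of_discrete (measure_ne_top _ _)
  have h2 : (prodBernoulli w).real ((openConn o c : Set (BondConfig (Fin n)))ᶜ \ ⋃ a ∈ A, (openConn o a : Set (BondConfig (Fin n)))) ≤
      (prodBernoulli w).real (⋃ a ∈ A, (openConn o a : Set (BondConfig (Fin n))))ᶜ := by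
    rw [Set.sdiff_eq]; exact measureReal_mono Set.inter_subset_right
  rw [Set.inter_comm] at hX
  linarith

end ApexForest

end Summit.CriticalPhenomena.PercolationContinuityZ3.Theorems
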